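import Literature.AlgebraicGeometry.Motives.MixedHodgeStructureHodgeNumbersAdditive
import Literature.AlgebraicGeometry.Motives.MixedHodgeStructureTateTwist
import Literature.LinearAlgebra.BaseChange.SubmoduleBaseChangeLattice
import HarnessLib

/-!
# Transport of a mixed Hodge structure along a linear equivalence

For a mixed `ℚ`-Hodge structure `H` on `W` and a `ℚ`-linear equivalence `e : V ≃ W`, the
**transported structure** `H.comapEquiv e` on `V` has `W_k = e⁻¹(W_k H)` and `F^p = e_ℂ⁻¹(F^p H)`;
the MHS axiom (Cattani–El Zein–Griffiths–Lê, Def. 3.2.15: `F` induces a Hodge structure of weight `k`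
on `Gr^W_k`, i.e. the two lattice identities of the tree's `MixedHodgeStructure.isCompl_grF_iff`) is
carried along the lattice isomorphism `U ↦ e_ℂ⁻¹ U`, which commutes with `⊓`, `⊔`, complexification and
complex conjugation.  Then `e : H.comapEquiv e → H` and `e⁻¹` are mutually inverse morphisms of MHS
(an isomorphism "given by the usual constructions" on the underlying spaces, Deligne, Hodge II, 2.3.1),
Hodge numbers and purity are preserved, and transport is functorial (`refl`, `trans`).  (The pure
analogue is the tree's `HodgeStructure.comapEquiv`, `Motives/GeometricVHSPolarizedTransport`.)

## Main results (definitions with bodies and theorems; no named facts)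

* `MixedHodgeStructure.comapEquiv H e`, `comapEquiv_W`, `comapEquiv_F`, `comapEquiv_refl`,
  `comapEquiv_trans`;
* `Hom.ofEquiv : Hom (H.comapEquiv e) H` (underlying `e`), `Hom.ofEquivSymm` (underlying `e⁻¹`),
  the two composites are identities, `Hom.ofEquiv_bijective`;
* `hodgeNumber_comapEquiv`, `IsPure.comapEquiv`.

## References

* [CattaniElZeinGriffithsLe2014] E. Cattani et al. (eds.), *Hodge Theory* (2014), Def. 3.2.15,
  Def. 3.2.16, Thm. 3.2.18.
* [DeligneHodgeII1971] P. Deligne, Théorie de Hodge II, 2.3.1, 1.1.5–1.1.11.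
-/

noncomputable section

open scoped TensorProduct

namespace Literature.AlgebraicGeometry.Motives

namespace MixedHodgeStructure

universe u v

variable {V : Type u} [AddCommGroup V] [Module ℚ V]
variable {W : Type v} [AddCommGroup W] [Module ℚ W]

open Module
open HodgeStructure (complexConj complexConj_comap_baseChange)
open Literature.LinearAlgebra.BaseChange (baseChange_comap)

/-- **Transport of a mixed Hodge structure along a linear equivalence**: for `H` on `W` and
`e : V ≃ W`, the MHS on `V` with `W_k = e⁻¹(W_k)` and `F^p = e_ℂ⁻¹(F^p)`; the graded-opposedness
axiom (Def. 3.2.15, in the lattice form `isCompl_grF_iff`) is transported along the lattice isomorphism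
`U ↦ e_ℂ⁻¹ U`. [cite: CattaniElZeinGriffithsLe2014, Def. 3.2.15] -/
def comapEquiv (H : MixedHodgeStructure W) (e : V ≃ₗ[ℚ] W) : MixedHodgeStructure V where
  W k := (H.W k).comap (e : V →ₗ[ℚ] W)
  monotone_W _ _ h := Submodule.comap_mono (H.monotone_W h)
  exists_W_eq_bot := by
    obtain ⟨k, hk⟩ := H.exists_W_eq_bot
    exact ⟨k, by rw [hk, Submodule.comap_bot, LinearEquiv.ker]⟩
  exists_W_eq_top := by
    obtain ⟨k, hk⟩ := H.exists_W_eq_top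
    exact ⟨k, by rw [hk, Submodule.comap_top]⟩
  F p := (H.F p).comap ((e : V →ₗ[ℚ] W).baseChange ℂ)
  antitone_F _ _ h := Submodule.comap_mono (H.antitone_F h)
  exists_F_eq_top := by
    obtain ⟨p, hp⟩ := H.exists_F_eq_top
    exact ⟨p, by rw [hp, Submodule.comap_top]⟩
  exists_F_eq_bot := by
    obtain ⟨p, hp⟩ := H.exists_F_eq_bot
    refine ⟨p, ?_⟩
    rw [hp, Submodule.comap_bot]
    exact LinearMap.ker_eq_bot.2 (baseChange_injective e.injective)
  isCompl_grF k p q hpq := by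
    obtain ⟨h1, h2⟩ := (isCompl_grF_iff H.W H.F k p q).1 (H.isCompl_grF k p q hpq)
    have t1 := congrArg (Submodule.orderIsoMapComap (e.baseChange ℚ ℂ V W)).symm h1
    have t2 := congrArg (Submodule.orderIsoMapComap (e.baseChange ℚ ℂ V W)).symm h2
    simp only [OrderIso.map_inf, OrderIso.map_sup, Submodule.orderIsoMapComap_symm_apply,
      LinearEquiv.coe_baseChange] at t1 t2
    rw [isCompl_grF_iff]
    simp only [← Submodule.comap_inf, complexConj_comap_baseChange, baseChange_comap]
    exact ⟨t1, t2⟩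

variable (H : MixedHodgeStructure W) (e : V ≃ₗ[ℚ] W)

/-- The weight filtration of the transported structure: `W_k = e⁻¹(W_k)`. [cite: CattaniElZeinGriffithsLe2014, Def. 3.2.15] -/
@[simp]
theorem comapEquiv_W (k : ℤ) : (H.comapEquiv e).W k = (H.W k).comap (e : V →ₗ[ℚ] W) := rfl

/-- The Hodge filtration of the transported structure: `F^p = e_ℂ⁻¹(F^p)`. [cite: CattaniElZeinGriffithsLe2014, Def. 3.2.15] -/
@[simp]
theorem comapEquiv_F (p : ℤ) :
    (H.comapEquiv e).F p = (H.F p).comap ((e : V →ₗ[ℚ] W).baseChange ℂ) := rfl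

/-- Transport along the identity does nothing. [cite: CattaniElZeinGriffithsLe2014, Def. 3.2.15] -/
theorem comapEquiv_refl : H.comapEquiv (LinearEquiv.refl ℚ W) = H :=
  ext_of_W_F (funext fun k => by rw [comapEquiv_W, LinearEquiv.refl_toLinearMap, Submodule.comap_id])
    (funext fun p => by
      rw [comapEquiv_F, LinearEquiv.refl_toLinearMap, LinearMap.baseChange_id, Submodule.comap_id])

/-- Transport is functorial: along `e₁ ≫ e₂` it is transport along `e₂` then along `e₁`.
[cite: CattaniElZeinGriffithsLe2014, Def. 3.2.15] -/
theorem comapEquiv_trans {U : Type*} [AddCommGroup U] [Module ℚ U] (e₁ : U ≃ₗ[ℚ] V) (e₂ : V ≃ₗ[ℚ] W) :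
    H.comapEquiv (e₁.trans e₂) = (H.comapEquiv e₂).comapEquiv e₁ :=
  ext_of_W_F (funext fun k => by
      rw [comapEquiv_W, comapEquiv_W, comapEquiv_W, LinearEquiv.coe_trans, Submodule.comap_comp])
    (funext fun p => by
      rw [comapEquiv_F, comapEquiv_F, comapEquiv_F, LinearEquiv.coe_trans, LinearMap.baseChange_comp,
        Submodule.comap_comp])

/-! ### `e` and `e⁻¹` as mutually inverse morphisms of MHS -/

/-- **`e : H.comapEquiv e → H` is a morphism of mixed Hodge structures** (`e(e⁻¹ W_k) ⊆ W_k`,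
`e_ℂ(e_ℂ⁻¹ F^p) ⊆ F^p`). [cite: CattaniElZeinGriffithsLe2014, Def. 3.2.16] -/
def Hom.ofEquiv : Hom (H.comapEquiv e) H where
  toLinearMap := (e : V →ₗ[ℚ] W)
  map_W_le _ := Submodule.map_comap_le _ _
  map_F_le _ := Submodule.map_comap_le _ _

/-- The underlying map of `Hom.ofEquiv` is `e`. [cite: CattaniElZeinGriffithsLe2014, Def. 3.2.16] -/
@[simp]
theorem Hom.ofEquiv_toLinearMap : (Hom.ofEquiv H e).toLinearMap = (e : V →ₗ[ℚ] W) := rfl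

/-- **`e⁻¹ : H → H.comapEquiv e` is a morphism of mixed Hodge structures.**
[cite: CattaniElZeinGriffithsLe2014, Def. 3.2.16] -/
def Hom.ofEquivSymm : Hom H (H.comapEquiv e) where
  toLinearMap := (e.symm : W →ₗ[ℚ] V)
  map_W_le k := by
    rw [Submodule.map_le_iff_le_comap]
    intro w hw
    rw [Submodule.mem_comap, comapEquiv_W, Submodule.mem_comap, LinearEquiv.coe_coe, LinearEquiv.coe_coe,
      LinearEquiv.apply_symm_apply]
    exact hw
  map_F_le p := by
    rw [Submodule.map_le_iff_le_comap]
    intro x hx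
    rw [Submodule.mem_comap, comapEquiv_F, Submodule.mem_comap, ← LinearEquiv.coe_baseChange,
      ← LinearEquiv.coe_baseChange, LinearEquiv.baseChange_symm, LinearEquiv.coe_coe, LinearEquiv.coe_coe,
      LinearEquiv.apply_symm_apply]
    exact hx

/-- The underlying map of `Hom.ofEquivSymm` is `e⁻¹`. [cite: CattaniElZeinGriffithsLe2014, Def. 3.2.16] -/
@[simp]
theorem Hom.ofEquivSymm_toLinearMap : (Hom.ofEquivSymm H e).toLinearMap = (e.symm : W →ₗ[ℚ] V) := rfl

/-- `e⁻¹ ∘ e = id` as morphisms of MHS. [cite: CattaniElZeinGriffithsLe2014, Def. 3.2.16] -/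
theorem Hom.ofEquivSymm_comp_ofEquiv :
    (Hom.ofEquivSymm H e).comp (Hom.ofEquiv H e) = Hom.id (H.comapEquiv e) :=
  Hom.ext (LinearMap.ext fun x => e.symm_apply_apply x)

/-- `e ∘ e⁻¹ = id` as morphisms of MHS. [cite: CattaniElZeinGriffithsLe2014, Def. 3.2.16] -/
theorem Hom.ofEquiv_comp_ofEquivSymm :
    (Hom.ofEquiv H e).comp (Hom.ofEquivSymm H e) = Hom.id H :=
  Hom.ext (LinearMap.ext fun x => e.apply_symm_apply x)

/-- `e : H.comapEquiv e → H` is an isomorphism of MHS. [cite: CattaniElZeinGriffithsLe2014, Thm. 3.2.18] -/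
theorem Hom.ofEquiv_bijective : Function.Bijective (Hom.ofEquiv H e).toLinearMap := e.bijective

/-- `e⁻¹ : H → H.comapEquiv e` is an isomorphism of MHS. [cite: CattaniElZeinGriffithsLe2014, Thm. 3.2.18] -/
theorem Hom.ofEquivSymm_bijective : Function.Bijective (Hom.ofEquivSymm H e).toLinearMap :=
  e.symm.bijective

/-! ### Invariants -/

/-- **Transport preserves Hodge numbers**: `h^{p,q}(H.comapEquiv e) = h^{p,q}(H)` (Hodge numbers are
invariant under isomorphisms of MHS, `Hom.hodgeNumber_eq_of_bijective`).
[cite: CattaniElZeinGriffithsLe2014, Thm. 3.2.18] -/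
theorem hodgeNumber_comapEquiv [FiniteDimensional ℚ V] [FiniteDimensional ℚ W] (p q : ℤ) :
    (H.comapEquiv e).hodgeNumber p q = H.hodgeNumber p q :=
  Hom.hodgeNumber_eq_of_bijective (Hom.ofEquiv H e) (Hom.ofEquiv_bijective H e) p q

/-- Transport preserves purity of weight `n`. [cite: CattaniElZeinGriffithsLe2014, Ex. 3.2.23 (1)] -/
theorem IsPure.comapEquiv {H : MixedHodgeStructure W} {n : ℤ} (h : H.IsPure n) (e : V ≃ₗ[ℚ] W) :
    (H.comapEquiv e).IsPure n := by
  refine ⟨fun k hk => ?_, fun k hk => ?_⟩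
  · rw [comapEquiv_W, h.1 k hk, Submodule.comap_bot, LinearEquiv.ker]
  · rw [comapEquiv_W, h.2 k hk, Submodule.comap_top]

/-- Transport preserves the weights: `W_{k-1} < W_k` for `H.comapEquiv e` iff for `H`.
[cite: CattaniElZeinGriffithsLe2014, Def. 3.2.15] -/
theorem isWeight_comapEquiv_iff (k : ℤ) : (H.comapEquiv e).IsWeight k ↔ H.IsWeight k := by
  simp only [IsWeight, comapEquiv_W]
  exact (Submodule.orderIsoMapComap e).symm.lt_iff_lt

/-- The transported structure of a Tate twist is the Tate twist of the transported structure.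
[cite: CattaniElZeinGriffithsLe2014, §3.2.2.7] -/
theorem comapEquiv_tateTwist (j : ℤ) : (H.tateTwist j).comapEquiv e = (H.comapEquiv e).tateTwist j :=
  ext_of_W_F (funext fun _ => rfl) (funext fun _ => rfl)

end MixedHodgeStructure

end Literature.AlgebraicGeometry.Motives

end
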